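import Summits.Schanuel.Schanuel.Theses.BenfordTowers
import Literature.NumberTheory.UniformDistribution.EquidistributedModOne
import Literature.NumberTheory.DiophantineApproximation.KroneckerTheorem

/-!
BC5 special case of the PARENT crux (crux strategist, stmt-Schanuel-11400): LEVEL `k = 0` of
`BenfordFamily` ("level 1 is Weyl's theorem"), with NO sorry.  For an admissible family whose words
are empty, the statistic is `n·θ` with `θ = ∑ c_m log_B a_m`; the non-vanishing of the symbol makes
`θ` irrational (linear independence of logarithms of primes over `ℤ` = unique factorisation, tree
`Kronecker.linearIndependent_log_of_prime`), and Weyl's theorem (tree `equidistributedModOne_nat_mul`,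
`EquidistributedModOne.isLittleO_weylSum`) gives the Weyl-sum bound.
-/

open Summit.Schanuel.Schanuel.Theses.BenfordTowers MvPolynomial Filter
open Literature.NumberTheory.UniformDistribution
open scoped BigOperators

namespace Summit.Schanuel.Schanuel.Cruxes.BenfordFamily.LevelZero

/-- At level `0` the statistic is linear: `S_F(n) = n · ∑ c_m log_B a_m`. -/
theorem statistic_level_zero (B : ℕ) (g : ℕ → ℕ → ℕ) :
    ∀ (F : List (ℤ × List ℕ × ℕ)), (∀ m ∈ F, m.2.1 = []) → ∀ n : ℕ,
      (F.map fun m => (m.1 : ℝ) * ((m.2.1.foldl g n : ℕ) : ℝ) * Real.logb B m.2.2).sum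
        = (n : ℝ) * (F.map fun m => (m.1 : ℝ) * Real.logb B m.2.2).sum := by
  intro F hF n
  induction F with
  | nil => simp
  | cons m F ih =>
    have hm : m.2.1 = [] := hF m (by simp)
    have hF' : ∀ m' ∈ F, m'.2.1 = [] := fun m' hm' => hF m' (by simp [hm'])
    simp only [List.map_cons, List.sum_cons]
    rw [ih hF', hm, List.foldl_nil]
    ring

/-- Coefficients of the level-`0` symbol: the coefficient of a monomial `mo` is the sum of the
integer weights of the members `m` with `X_{a_m} = X^{mo}`. -/
theorem coeff_symbol_level_zero (mo : ℕ →₀ ℕ) :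
    ∀ (F : List (ℤ × List ℕ × ℕ)), (∀ m ∈ F, m.2.1 = []) →
      coeff mo (F.map fun m => C (m.1 : ℚ) * (m.2.1.map (X (R := ℚ))).prod * X m.2.2).sum
        = (((F.filter fun m => Finsupp.single m.2.2 1 = mo).map fun m => (m.1 : ℚ))).sum := by
  intro F hF
  induction F with
  | nil => simp
  | cons m F ih =>
    have hm : m.2.1 = [] := hF m (by simp)
    have hF' : ∀ m' ∈ F, m'.2.1 = [] := fun m' hm' => hF m' (by simp [hm'])
    simp only [List.map_cons, List.sum_cons, coeff_add, List.filter_cons]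
    rw [ih hF', hm, List.map_nil, List.prod_nil, mul_one, coeff_C_mul, coeff_X]
    by_cases h : Finsupp.single m.2.2 1 = mo
    · simp [h]
    · simp [h]

/-- Fibrewise regrouping of a list sum over a finset containing all the outer letters. -/
theorem list_sum_eq_finset_sum (f : ℕ → ℝ) (S : Finset ℕ) :
    ∀ (F : List (ℤ × List ℕ × ℕ)), (∀ m ∈ F, m.2.2 ∈ S) →
      (F.map fun m => (m.1 : ℝ) * f m.2.2).sum
        = ∑ p ∈ S, ((((F.filter fun m => m.2.2 = p).map fun m => m.1)).sum : ℤ) * f p := by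
  intro F hF
  induction F with
  | nil => simp
  | cons m F ih =>
    have hm : m.2.2 ∈ S := hF m (by simp)
    have hF' : ∀ m' ∈ F, m'.2.2 ∈ S := fun m' hm' => hF m' (by simp [hm'])
    rw [List.map_cons, List.sum_cons, ih hF']
    have hfib : ∀ p, (((List.filter (fun m' => m'.2.2 = p) (m :: F)).map fun m' => m'.1).sum : ℤ)
        = (if m.2.2 = p then m.1 else 0)
          + ((List.filter (fun m' => m'.2.2 = p) F).map fun m' => m'.1).sum := by
      intro p
      rw [List.filter_cons]
      by_cases h : m.2.2 = p <;> simp [h]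
    simp_rw [hfib]
    push_cast
    simp_rw [add_mul]
    rw [Finset.sum_add_distrib]
    congr 1
    rw [Finset.sum_eq_single_of_mem m.2.2 hm (fun p _ hp => by simp [Ne.symm hp])]
    simp

/-- The level-`0` symbol vanishes when every outer-letter fibre sum does. -/
theorem symbol_eq_zero_of_fibres (F : List (ℤ × List ℕ × ℕ)) (hF : ∀ m ∈ F, m.2.1 = [])
    (h : ∀ a : ℕ, (((F.filter fun m => m.2.2 = a).map fun m => m.1).sum : ℤ) = 0) :
    (F.map fun m => C (m.1 : ℚ) * (m.2.1.map (X (R := ℚ))).prod * X m.2.2).sum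
      = (0 : MvPolynomial ℕ ℚ) := by
  ext mo
  rw [coeff_symbol_level_zero mo F hF, coeff_zero]
  by_cases hex : ∃ m ∈ F, Finsupp.single m.2.2 1 = mo
  · obtain ⟨m₀, hm₀, hmo⟩ := hex
    have hfilter : (F.filter fun m => Finsupp.single m.2.2 1 = mo)
        = F.filter fun m => m.2.2 = m₀.2.2 := by
      apply List.filter_congr
      intro m _
      simp only [decide_eq_decide]
      rw [← hmo]
      exact Finsupp.single_left_inj one_ne_zero
    rw [hfilter]
    have hcast : ((F.filter fun m => m.2.2 = m₀.2.2).map fun m => (m.1 : ℚ)).sum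
        = ((((F.filter fun m => m.2.2 = m₀.2.2).map fun m => m.1).sum : ℤ) : ℚ) := by
      rw [Int.cast_list_sum, List.map_map]
      rfl
    rw [hcast, h m₀.2.2, Int.cast_zero]
  · push Not at hex
    rw [List.filter_eq_nil_iff.mpr (fun m hm => by simpa using hex m hm)]
    simp

/-- **Level `k = 0` of `BenfordFamily`, PROVED** (BC5 for the parent crux; "level 1 is Weyl's
theorem"): for an admissible family with empty words and non-zero symbol, the Weyl sums of
`h·S_F(n) = h·n·∑ c_m log_B a_m` are `o(N)`. -/
theorem benfordFamily_level_zero :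
    ∀ (B : ℕ) (F : List (ℤ × List ℕ × ℕ)), B.Prime →
      (∀ m ∈ F, m.2.1.length = 0 ∧ (∀ p ∈ m.2.1, p.Prime ∧ p ≠ B) ∧ m.2.2.Prime ∧ m.2.2 ≠ B) →
      (F.map fun m => C (m.1 : ℚ) * (m.2.1.map (X (R := ℚ))).prod * X m.2.2).sum
          ≠ (0 : MvPolynomial ℕ ℚ) →
      ∀ h : ℤ, h ≠ 0 →
        (fun N : ℕ => ∑ n ∈ Finset.range N, Complex.exp (2 * Real.pi * Complex.I *
          (((h : ℝ) * (F.map fun m => (m.1 : ℝ) *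
            ((m.2.1.foldl (fun e p => (Nat.digits B (p ^ e)).length) n : ℕ) : ℝ) *
            Real.logb B m.2.2).sum : ℝ) : ℂ)))
        =o[atTop] fun N : ℕ => (N : ℝ) := by
  intro B F hB hF hsym h hh
  classical
  have hnil : ∀ m ∈ F, m.2.1 = [] := fun m hm => List.eq_nil_of_length_eq_zero (hF m hm).1
  set θ : ℝ := (F.map fun m => (m.1 : ℝ) * Real.logb B m.2.2).sum with hθ
  -- (1) `θ` is irrational: otherwise the symbol vanishes
  have hirr : Irrational θ := by
    rintro ⟨q, hq⟩
    apply hsym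
    apply symbol_eq_zero_of_fibres F hnil
    set S : Finset ℕ := insert B (F.map fun m => m.2.2).toFinset with hS
    have hSprime : ∀ p ∈ S, p.Prime := by
      intro p hp
      rw [hS, Finset.mem_insert, List.mem_toFinset, List.mem_map] at hp
      rcases hp with rfl | ⟨m, hm, rfl⟩
      · exact hB
      · exact (hF m hm).2.2.1
    have hmem : ∀ m ∈ F, m.2.2 ∈ S := fun m hm =>
      Finset.mem_insert_of_mem (List.mem_toFinset.mpr (List.mem_map.mpr ⟨m, hm, rfl⟩))
    have hBS : B ∈ S := Finset.mem_insert_self _ _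
    have hlogB : Real.log B ≠ 0 := (Real.log_pos (by exact_mod_cast hB.one_lt)).ne'
    -- `θ · log B = ∑_p fibre(p) · log p`
    have hθlog : θ * Real.log B
        = ∑ p ∈ S, ((((F.filter fun m => m.2.2 = p).map fun m => m.1)).sum : ℤ) * Real.log p := by
      rw [← list_sum_eq_finset_sum (fun p => Real.log p) S F hmem, hθ, ← List.sum_map_mul_right]
      refine congrArg List.sum (List.map_congr_left fun m _ => ?_)
      rw [Real.logb, mul_assoc, div_mul_cancel₀ _ hlogB]
    have hqd : (q : ℝ) * q.den = q.num := by exact_mod_cast Rat.mul_den_eq_num q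
    -- the integer relation among the `log p`, `p ∈ S`
    have hrel : ∑ p ∈ S, (((q.den : ℤ) * (((F.filter fun m => m.2.2 = p).map fun m => m.1)).sum
        - (if p = B then q.num else 0) : ℤ) : ℝ) * Real.log p = 0 := by
      have hsplit : ∀ p ∈ S, (((q.den : ℤ) * (((F.filter fun m => m.2.2 = p).map fun m => m.1)).sum
          - (if p = B then q.num else 0) : ℤ) : ℝ) * Real.log p
          = (q.den : ℝ) * (((((F.filter fun m => m.2.2 = p).map fun m => m.1)).sum : ℤ) * Real.log p)
            - (if p = B then (q.num : ℝ) * Real.log p else 0) := by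
        intro p _
        by_cases hp : p = B
        · simp [hp]; ring
        · simp [hp]; ring
      rw [Finset.sum_congr rfl hsplit, Finset.sum_sub_distrib, ← Finset.mul_sum, ← hθlog,
        Finset.sum_ite_eq' S B, if_pos hBS, ← hq]
      linear_combination (Real.log B) * hqd
    have hli := Literature.NumberTheory.DiophantineApproximation.Kronecker.linearIndependent_log_of_prime
      S hSprime
    have hrel' : ∑ p : S, ((q.den : ℤ) * (((F.filter fun m => m.2.2 = (p : ℕ)).map fun m => m.1)).sum
        - (if (p : ℕ) = B then q.num else 0)) • Real.log ((p : ℕ) : ℝ) = 0 := by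
      rw [← hrel, ← Finset.sum_coe_sort S]
      refine Finset.sum_congr rfl fun p _ => ?_
      rw [zsmul_eq_mul]
    have hκ := Fintype.linearIndependent_iff.mp hli _ hrel'
    intro a
    by_cases haF : ∃ m ∈ F, m.2.2 = a
    · obtain ⟨m, hm, rfl⟩ := haF
      have hne : m.2.2 ≠ B := (hF m hm).2.2.2
      have hz := hκ ⟨m.2.2, hmem m hm⟩
      simp only [hne, if_false, sub_zero] at hz
      exact (mul_eq_zero.mp hz).resolve_left (by exact_mod_cast q.den_nz)
    · push Not at haF
      rw [List.filter_eq_nil_iff.mpr (fun m hm => by simpa using haF m hm)]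
      simp
  -- (2) Weyl's theorem for `n θ`
  have hstat : ∀ n : ℕ, (F.map fun m => (m.1 : ℝ) *
      ((m.2.1.foldl (fun e p => (Nat.digits B (p ^ e)).length) n : ℕ) : ℝ) *
      Real.logb B m.2.2).sum = (n : ℝ) * θ :=
    statistic_level_zero B _ F hnil
  have hud := (equidistributedModOne_nat_mul hirr).isLittleO_weylSum hh
  have heq : (fun N : ℕ => ∑ n ∈ Finset.range N, Complex.exp (2 * Real.pi * Complex.I *
      (((h : ℝ) * (F.map fun m => (m.1 : ℝ) *
        ((m.2.1.foldl (fun e p => (Nat.digits B (p ^ e)).length) n : ℕ) : ℝ) *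
        Real.logb B m.2.2).sum : ℝ) : ℂ)))
      = fun N : ℕ => ∑ n ∈ Finset.range N, Complex.exp (2 * Real.pi * Complex.I *
          (((h : ℝ) * ((n : ℝ) * θ) : ℝ) : ℂ)) := by
    funext N
    refine Finset.sum_congr rfl fun n _ => ?_
    rw [hstat n]
  rw [heq]
  exact hud

end Summit.Schanuel.Schanuel.Cruxes.BenfordFamily.LevelZero
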